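import Summits.QuantumFields.YangMills.Theorems.BalabanUVNodesN15FullPropagatorC2BgExactUnitN15At

/-!
# Route «BalabanUVNodes», cluster K4 «SpineRates» — node N15 = NE2, file V-F (dag-n15-a g17, programme V): THE SOCKET — `NE2PlusUnit` ∕ `N15At` with the EXACTLY DRESSED
# U-seeing (2.156) unit layer for ANY instance family on the TwoGrid carriers and ANY middle-factor maps with U-C3-shaped letters (V-D is the instance at dag-n15-c's
# primitive-carrier species; n15-c's other families plug in by letters alone)

Cell `pub-ymgap`, seat `pub-ymgap-dag-n15-a` (-a KNIT-BY-NAME seat of node N15; HUMAN RULING D-0062; chair R424 venue), generation 17, file V-F of programme V.  `bears_on: R4∕N15 · K3⁷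
SpineGivenEndpointR13SepCoPH (stmt-QuantumFields-20544)`.  Filed `--kind proof --supports stmt-QuantumFields-20544 --as helper` — COUNT-NEUTRAL.  Two data `def`s (`covEx`, the site
kernel `tgCovExOn`), the rest theorems; 0 `sorry`.  Imports V-D (and through it V-A…V-C, U-A, part 78); nothing in the tree is modified.

WHY.  V-D's `ne2PlusUnit_tgCovBgEx` reads ONE thing of dag-n15-c's species: U-C3's three entry letters of the middle factor `Z(U) = unitBondMat (Q(E₀(U) − G)Q*)` —
`|Z(Ū)|, |Z′(U)| ≤ ζα₀e^{−δ_Zρ}`, `|Z′(U) − Z(Ū)| ≤ τθ_Z^ke^{−δ_Zρ}`.  This file abstracts them: for ANY family `pi i = ⟨tgGeoC (ι i), gf i, Bc i, Bf i, pair i⟩` (part 78's shape) and ANY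
maps `Zf i : (Bf i).Cfg → bond matrices` (fine run, fineness `L^mL^k`), `Zc i : (Bc i).Cfg → bond matrices` (coarse run, fineness `L^k`) with those letters, the exactly dressed
(2.156) difference kernel satisfies `NE2PlusUnit` BY NAME, and an operator layer BY NAME on the same family gives `N15At` (part 78's knit with the U-seeing unit layer in place of
the U-blind `tgCovOn`).  dag-n15-c's Slim ∕ matrix-line families then need only their letters.

WHAT.  §1 def `covEx M n b Z := C(C*(Δ^{(n)} + exDress b Δ^{(n)} Z)C)⁻¹C*`, `covBgEx_eq_covEx` (V-D's instance, `rfl`), def `tgCovExOn`, `tgCovExOn_ker`, ★ `tgCovBgEx_eq_tgCovExOn` (V-D's kernel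
IS the socket at `Zf = unitBondMat ∘ zOp^{(L^mL^k)}`, `Zc = unitBondMat ∘ zOp^{(L^k)}`; `rfl`), `tgCovExOn_of_zero` (where both middle factors vanish the kernel is part 76's `covDiff`).
§2 ★★★ **`ne2PlusUnit_tgCovExOn_of_letters`** (`d ≥ 1`, odd `L ≥ 3`, `b > 0`, indices in `m_T ≥ 1`, guard scales `(gf i).M ≥ 1`, a rate `L⁻¹ ≤ θ_Z < 1`; the letters as ONE
hypothesis `hZ`) ⟹ `NE2PlusUnit c₃₅ pi (tgCovExOn …) ⊤ dist` with `(δ₀, a₀, B₀, θ_Z)` after `d, L, b` and the letters' constants.  §3 ★★★ **`n15At_tgEx_of_ne2PlusOperator`**: an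
operator layer `NE2PlusOperator c₃₅ pi Kop` BY NAME + the letters ⟹ `N15At ⟨I, c₃₅, p, pi, Kop, tgSiteOn a_S, tgCovExOn, ⊤, dist⟩`.

HONEST FRAMING.  Count-neutral SOCKET (bookkeeping + V-C∕U-A by name); the letters `hZ` are a HYPOTHESIS here (discharged for dag-n15-c's primitive-carrier species by U-C3 — that
instance is V-D); MODEL-LEVEL wherever instantiated by a model species; `Q` abelianised and `Sym` in the bond basis as in V-B∕V-D.  NOT [B9] Thm 3.15 at a general (3.35)-regular `U`;
N15 NOT discharged (typed 28∕28 · discharged 5∕27 of record unchanged); nothing continuum ∕ ℝ⁴ ∕ OS ∕ mass-gap ∕ Clay.  Restate-immune (no Theses import).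
-/

set_option autoImplicit false

noncomputable section

open scoped BigOperators
open Finset

namespace Summit.QuantumFields.YangMills.BalabanUVNodes.N15.UnitLayerBg

open Literature.MathematicalPhysics.QuantumFieldTheory.Balaban1983to89
open Literature.MathematicalPhysics.QuantumFieldTheory.Balaban1983to89.T4EtaRate (PairedInstance EtaPairing NE2PlusOperator NE2PlusSite NE2PlusUnit EtaRateIneqUnit)
open Literature.MathematicalPhysics.QuantumFieldTheory.Balaban1983to89.T4EtaRateUnitWitness (covDiff)
open Literature.MathematicalPhysics.QuantumFieldTheory.Balaban1983to89.B5Prop11Plancherel (Tor fine)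
open Literature.MathematicalPhysics.QuantumFieldTheory.Balaban1983to89.B6Lemma24Torus (pbox)
open Literature.MathematicalPhysics.QuantumFieldTheory.Balaban1983to89.B6BondEliminationTorus (pdist)
open Literature.MathematicalPhysics.QuantumFieldTheory.Balaban1983to89.B6Cov2156Torus (deltaPol bondReductionT one_le_M)
open Literature.MathematicalPhysics.QuantumFieldTheory.Balaban1983to89.B6LowerBound2153Torus (rep rep_mem_pbox)
open Literature.MathematicalPhysics.QuantumFieldTheory.Balaban1983to89.B6UnitTorusCarrier (pdist_rep_rep)
open Literature.MathematicalPhysics.QuantumFieldTheory.King1986.Torus (tdistT)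
open Summit.QuantumFields.YangMills.BalabanUVNodes.N15.TwoGrid (TGIndex tgGeoC)
open Summit.QuantumFields.YangMills.BalabanUVNodes.N15.VectorPiece (kingPrV)
open Summit.QuantumFields.YangMills.BalabanUVNodes.N15.BackgroundLayer (avg₁ fgInstanceC2)
open Summit.QuantumFields.YangMills.BalabanUVNodes.N15.GenuineRecord (tgSiteOn ne2PlusSite_tgSiteOn)
open YMDAG.UVSplit (N15At)

variable {d : ℕ} {L : ℕ} [NeZero L]

/-! ## §1 The exactly dressed covariance as a function of the middle factor; the socket kernel -/

section Kernel

/-- THE EXACTLY DRESSED (2.156) COVARIANCE AS A FUNCTION OF THE MIDDLE FACTOR: `C_ex^{(n)}(Z) := C(C*(Δ^{(n)} + exDress b Δ^{(n)} Z)C)⁻¹C*` on the unit torus `M` — by V-C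
`smul_one_add_deltaPol_add_exDress`, `Δ^{(n)} + exDress b Δ^{(n)} Z = (unitBondMat (Q_nG_nQ_n*) + Sym Z)⁻¹ − b·1`. [cite: Balaban1984PropagatorsII, (2.156) p.250 (object); Balaban1984PropagatorsI, (1.103) p.34] -/
def covEx (M : Fin (d + 1) → ℕ) [∀ μ, NeZero (M μ)] (n : ℕ) (b : ℝ) (Z : Matrix (B4.Idx (pbox M) (d + 1)) (B4.Idx (pbox M) (d + 1)) ℝ) :
    Matrix (B4.Idx (pbox M) (d + 1)) (B4.Idx (pbox M) (d + 1)) ℝ :=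
  (bondReductionT L M (deltaPol M n + exDress b (deltaPol M n) Z)).cov

omit [NeZero L] in
/-- V-D's `covBgEx` IS `covEx` at the species' middle factor (`rfl`). [bookkeeping] -/
theorem covBgEx_eq_covEx (M : Fin (d + 1) → ℕ) [∀ μ, NeZero (M μ)] (n : ℕ) [NeZero n] (b : ℝ) (c : Tor (fine n M) × Fin (d + 1) → ℝ)
    (a : Fin (d + 1) → Tor (fine n M) × Fin (d + 1) → ℝ) :
    covBgEx (L := L) M n b c a = covEx (L := L) M n b (unitBondMat M (zOp d M n b c a)) := rfl

variable {I : Type} (ι : I → TGIndex) (gf : I → B9.Geometry) (Bc Bf : I → B9.Backgrounds)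

/-- ★ **THE SOCKET KERNEL**: on the family `pi i = ⟨tgGeoC (ι i), gf i, Bc i, Bf i, pair i⟩` with fine-run middle factors `Zf i : (Bf i).Cfg → bonds × bonds` (fineness `L^mL^k`) and
coarse-run middle factors `Zc i : (Bc i).Cfg → bonds × bonds` (fineness `L^k`): `(U, y, y′) ↦ C_ex^{(L^mL^k)}(Zf i U)((ȳ,α),(ȳ′,β)) − C_ex^{(L^k)}(Zc i (avg U))((ȳ,α),(ȳ′,β))`.
[cite: Balaban1985BackgroundPropagators, Thm 3.15 (3.185)–(3.187) p.432 (shape of `C^{(k)}(Λ)(U)`)] -/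
def tgCovExOn (d : ℕ) (hL : Odd L ∧ 1 < L) (b : ℝ) (α β : Fin (d + 1)) (pair : ∀ i, EtaPairing (tgGeoC d hL (ι i)) (gf i) (Bc i) (Bf i))
    (Zf : ∀ i, (Bf i).Cfg → Matrix (B4.Idx (pbox (TGIndex.Mn d hL (ι i))) (d + 1)) (B4.Idx (pbox (TGIndex.Mn d hL (ι i))) (d + 1)) ℝ)
    (Zc : ∀ i, (Bc i).Cfg → Matrix (B4.Idx (pbox (TGIndex.Mn d hL (ι i))) (d + 1)) (B4.Idx (pbox (TGIndex.Mn d hL (ι i))) (d + 1)) ℝ) (i : I) :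
    B9.SiteKernel (tgGeoC d hL (ι i)) (Bf i) :=
  ⟨fun U y y' =>
    covEx (L := L) (TGIndex.Mn d hL (ι i)) (L ^ (ι i).m * L ^ (ι i).k) b (Zf i U)
        (⟨rep (TGIndex.Mn d hL (ι i)) y, rep_mem_pbox (TGIndex.Mn d hL (ι i)) y⟩, α) (⟨rep (TGIndex.Mn d hL (ι i)) y', rep_mem_pbox (TGIndex.Mn d hL (ι i)) y'⟩, β)
      - covEx (L := L) (TGIndex.Mn d hL (ι i)) (L ^ (ι i).k) b (Zc i ((pair i).avg U))
        (⟨rep (TGIndex.Mn d hL (ι i)) y, rep_mem_pbox (TGIndex.Mn d hL (ι i)) y⟩, α) (⟨rep (TGIndex.Mn d hL (ι i)) y', rep_mem_pbox (TGIndex.Mn d hL (ι i)) y'⟩, β)⟩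

/-- Unfolding of `tgCovExOn`. [folklore] -/
theorem tgCovExOn_ker (hL : Odd L ∧ 1 < L) (b : ℝ) (α β : Fin (d + 1)) (pair : ∀ i, EtaPairing (tgGeoC d hL (ι i)) (gf i) (Bc i) (Bf i))
    (Zf : ∀ i, (Bf i).Cfg → Matrix (B4.Idx (pbox (TGIndex.Mn d hL (ι i))) (d + 1)) (B4.Idx (pbox (TGIndex.Mn d hL (ι i))) (d + 1)) ℝ)
    (Zc : ∀ i, (Bc i).Cfg → Matrix (B4.Idx (pbox (TGIndex.Mn d hL (ι i))) (d + 1)) (B4.Idx (pbox (TGIndex.Mn d hL (ι i))) (d + 1)) ℝ) (i : I) (U : (Bf i).Cfg)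
    (y y' : Tor (TGIndex.Mn d hL (ι i))) :
    (tgCovExOn ι gf Bc Bf d hL b α β pair Zf Zc i).ker U y y' =
      covEx (L := L) (TGIndex.Mn d hL (ι i)) (L ^ (ι i).m * L ^ (ι i).k) b (Zf i U)
          (⟨rep (TGIndex.Mn d hL (ι i)) y, rep_mem_pbox (TGIndex.Mn d hL (ι i)) y⟩, α) (⟨rep (TGIndex.Mn d hL (ι i)) y', rep_mem_pbox (TGIndex.Mn d hL (ι i)) y'⟩, β)
        - covEx (L := L) (TGIndex.Mn d hL (ι i)) (L ^ (ι i).k) b (Zc i ((pair i).avg U))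
          (⟨rep (TGIndex.Mn d hL (ι i)) y, rep_mem_pbox (TGIndex.Mn d hL (ι i)) y⟩, α) (⟨rep (TGIndex.Mn d hL (ι i)) y', rep_mem_pbox (TGIndex.Mn d hL (ι i)) y'⟩, β) := rfl

/-- ★ **V-D's KERNEL IS THE SOCKET** at dag-n15-c's primitive-carrier species: `tgCovBgEx d hL b α β i = tgCovExOn Prod.fst … (unitBondMat ∘ zOp^{(L^mL^k)}) (unitBondMat ∘ zOp^{(L^k)}) i`
(`rfl`). [bookkeeping] -/
theorem tgCovBgEx_eq_tgCovExOn (hL : Odd L ∧ 1 < L) (b : ℝ) (α β : Fin (d + 1)) (i : TGIndex × Fin (d + 1)) :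
    tgCovBgEx d hL b α β i =
      tgCovExOn (fun i : TGIndex × Fin (d + 1) => i.1) (fun i => (fgInstanceC2 d hL i).gf) (fun i => (fgInstanceC2 d hL i).Bc) (fun i => (fgInstanceC2 d hL i).Bf) d hL b α β
        (fun i => (fgInstanceC2 d hL i).pair)
        (fun i U => unitBondMat (TGIndex.Mn d hL i.1) (zOp d (TGIndex.Mn d hL i.1) (L ^ i.1.m * L ^ i.1.k) b U.1 U.2))
        (fun i V => unitBondMat (TGIndex.Mn d hL i.1) (zOp d (TGIndex.Mn d hL i.1) (L ^ i.1.k) b V.1 V.2)) i := rfl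

/-- Where both middle factors vanish the socket kernel IS part 76's genuine (2.156) difference `covDiff` (`b > 0`; V-C `exDress_deltaPol_zero`). [cite: Balaban1984PropagatorsII, (2.156) p.250 (object)] -/
theorem tgCovExOn_of_zero (hL : Odd L ∧ 1 < L) {b : ℝ} (hb : 0 < b) (α β : Fin (d + 1)) (pair : ∀ i, EtaPairing (tgGeoC d hL (ι i)) (gf i) (Bc i) (Bf i))
    (Zf : ∀ i, (Bf i).Cfg → Matrix (B4.Idx (pbox (TGIndex.Mn d hL (ι i))) (d + 1)) (B4.Idx (pbox (TGIndex.Mn d hL (ι i))) (d + 1)) ℝ)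
    (Zc : ∀ i, (Bc i).Cfg → Matrix (B4.Idx (pbox (TGIndex.Mn d hL (ι i))) (d + 1)) (B4.Idx (pbox (TGIndex.Mn d hL (ι i))) (d + 1)) ℝ) (i : I) (U : (Bf i).Cfg)
    (hf : Zf i U = 0) (hc : Zc i ((pair i).avg U) = 0) (y y' : Tor (TGIndex.Mn d hL (ι i))) :
    (tgCovExOn ι gf Bc Bf d hL b α β pair Zf Zc i).ker U y y' =
      covDiff L (TGIndex.Mn d hL (ι i)) (ι i).k (ι i).m (⟨rep (TGIndex.Mn d hL (ι i)) y, rep_mem_pbox (TGIndex.Mn d hL (ι i)) y⟩, α)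
        (⟨rep (TGIndex.Mn d hL (ι i)) y', rep_mem_pbox (TGIndex.Mn d hL (ι i)) y'⟩, β) := by
  have hL1 : 1 ≤ L := by have := hL.2; omega
  have hLk : 1 ≤ L ^ (ι i).k := Nat.one_le_pow _ _ hL1
  have hLmk : 1 ≤ L ^ (ι i).m * L ^ (ι i).k := Nat.one_le_iff_ne_zero.mpr (Nat.mul_ne_zero (by have := Nat.one_le_pow (ι i).m L hL1; omega) (by omega))
  haveI : NeZero (L ^ (ι i).k) := ⟨by omega⟩
  haveI : NeZero (L ^ (ι i).m * L ^ (ι i).k) := ⟨by omega⟩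
  rw [tgCovExOn_ker, hf, hc]
  unfold covEx covDiff
  rw [exDress_deltaPol_zero (L ^ (ι i).m * L ^ (ι i).k) _ hLmk hb, exDress_deltaPol_zero (L ^ (ι i).k) _ hLk hb, add_zero, add_zero,
    show L ^ (ι i).m * L ^ (ι i).k = L ^ ((ι i).k + (ι i).m) by rw [pow_add, mul_comm]]

end Kernel

/-! ## §2 ★★★ The socket: U-C3-shaped letters ⟹ `NE2PlusUnit` by name -/

section Socket

variable {I : Type} (ι : I → TGIndex) (gf : I → B9.Geometry) (Bc Bf : I → B9.Backgrounds)

/-- ★★★ **THE SOCKET — `NE2PlusUnit` BY NAME FROM THE MIDDLE FACTORS' LETTERS ALONE.**  Let `d ≥ 1`, `L ≥ 3` odd, `b > 0`, `c₃₅`, directions `α β`; a family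
`pi i = ⟨tgGeoC (ι i), gf i, Bc i, Bf i, pair i⟩` with indices in `m_T ≥ 1` (L-divisible tori) and guard scales `(gf i).M ≥ 1`; a rate `θ_Z` with `L⁻¹ ≤ θ_Z < 1`; and middle-factor maps
`Zf`, `Zc` with THE THREE LETTERS: there are `δ_Z, ζ, τ, a₁ > 0` such that for every `i`, every `0 < α₀ ≤ a₁` and every `U` regular at level `c₃₅` (`Reg335 c₃₅ α₀ U`),
`|Zc i (avg U)|, |Zf i U| ≤ ζα₀·e^{−δ_Zρ}` and `|Zf i U − Zc i (avg U)| ≤ τ·θ_Z^k·e^{−δ_Zρ}` (bondwise).  THEN `NE2PlusUnit c₃₅ pi (tgCovExOn …) ⊤ dist` with constants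
`(δ₀, a₀, B₀, θ_Z)` — `a₀ = min a₁ (min (ζ₀∕ζ) (ε₀∕(Kζ)))` a smallness in `α₀` ALONE (V-C's `ζ₀`, U-A's `epsCov`), `B₀ = C′(1 + K(τ+1)) + 1`; NO weight window, NO Neumann series.
Chain: `hZ` → V-C `exDress_deltaPol_letters` → U-A `cov2156_rate_torus_add`. [cite: Balaban1985BackgroundPropagators, Thm 3.15 (3.185)–(3.187) p.432 (quantifier template, shape);
Balaban1984PropagatorsII, (2.153)–(2.157) pp.249–250; Balaban1984PropagatorsI, (1.102)–(1.103) p.34; King1986, Lemma 4.5 (4.38)–(4.41) pp.674–675; CombesThomas1973, §II] -/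
theorem ne2PlusUnit_tgCovExOn_of_letters (hd : 1 ≤ d) (hL2 : 2 ≤ L) (hL : Odd L ∧ 1 < L) {b : ℝ} (hb : 0 < b) (c35 : ℝ) (α β : Fin (d + 1))
    (hι : ∀ i, 1 ≤ (ι i).mT) (hM : ∀ i, 1 ≤ (gf i).M) (pair : ∀ i, EtaPairing (tgGeoC d hL (ι i)) (gf i) (Bc i) (Bf i))
    (Zf : ∀ i, (Bf i).Cfg → Matrix (B4.Idx (pbox (TGIndex.Mn d hL (ι i))) (d + 1)) (B4.Idx (pbox (TGIndex.Mn d hL (ι i))) (d + 1)) ℝ)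
    (Zc : ∀ i, (Bc i).Cfg → Matrix (B4.Idx (pbox (TGIndex.Mn d hL (ι i))) (d + 1)) (B4.Idx (pbox (TGIndex.Mn d hL (ι i))) (d + 1)) ℝ)
    {θZ : ℝ} (hθL : (L : ℝ)⁻¹ ≤ θZ) (hθ1 : θZ < 1)
    (hZ : ∃ δZ ζ τ a₁ : ℝ, 0 < δZ ∧ 0 < ζ ∧ 0 < τ ∧ 0 < a₁ ∧
      ∀ (i : I) (α₀ : ℝ), 0 < α₀ → α₀ ≤ a₁ → ∀ U : (Bf i).Cfg, (Bf i).Reg335 c35 α₀ U →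
        (∀ p q : B4.Idx (pbox (TGIndex.Mn d hL (ι i))) (d + 1),
            |Zc i ((pair i).avg U) p q| ≤ ζ * α₀ * Real.exp (-(δZ * pdist (TGIndex.Mn d hL (ι i)) (one_le_M _) (p.1 : Fin (d + 1) → ℤ) (q.1 : Fin (d + 1) → ℤ)))) ∧
        (∀ p q : B4.Idx (pbox (TGIndex.Mn d hL (ι i))) (d + 1),
            |Zf i U p q| ≤ ζ * α₀ * Real.exp (-(δZ * pdist (TGIndex.Mn d hL (ι i)) (one_le_M _) (p.1 : Fin (d + 1) → ℤ) (q.1 : Fin (d + 1) → ℤ)))) ∧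
        (∀ p q : B4.Idx (pbox (TGIndex.Mn d hL (ι i))) (d + 1),
            |Zf i U p q - Zc i ((pair i).avg U) p q| ≤ τ * θZ ^ (ι i).k * Real.exp (-(δZ * pdist (TGIndex.Mn d hL (ι i)) (one_le_M _) (p.1 : Fin (d + 1) → ℤ) (q.1 : Fin (d + 1) → ℤ))))) :
    NE2PlusUnit c35 (fun i => (⟨tgGeoC d hL (ι i), gf i, Bc i, Bf i, pair i⟩ : PairedInstance)) (tgCovExOn ι gf Bc Bf d hL b α β pair Zf Zc) (fun _ _ => True)
      (fun i => (tgGeoC d hL (ι i)).dist) := by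
  have hL1 : 1 ≤ L := by omega
  have hLpos : (0 : ℝ) < L := by exact_mod_cast (lt_of_lt_of_le zero_lt_two hL2)
  have hθ0 : 0 < θZ := lt_of_lt_of_le (inv_pos.mpr hLpos) hθL
  obtain ⟨δZ, ζ, τ, a₁, hδZ, hζ, hτ, ha₁, HZ⟩ := hZ
  obtain ⟨K, δ', ζ₀, hK, hδ', hζ₀, HP⟩ := exDress_deltaPol_letters (d + 1) (by omega) hb hδZ
  obtain ⟨C', δ'', hC', hδ'', HC⟩ := cov2156_rate_torus_add (d + 1) (by omega) hL1 (δP := δ') hδ'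
  have hε₀ := epsCov_pos (d := d + 1) (L := L) (by omega) hL1 hδ'
  have hKζ : 0 < K * ζ := by positivity
  obtain ⟨a₀, ha₀def⟩ : ∃ a₀ : ℝ, a₀ = min a₁ (min (ζ₀ / ζ) (epsCov (d + 1) L δ' / (K * ζ))) := ⟨_, rfl⟩
  have ha₀ : 0 < a₀ := by rw [ha₀def]; exact lt_min ha₁ (lt_min (div_pos hζ₀ hζ) (div_pos hε₀ hKζ))
  refine ⟨δ'', a₀, C' * (1 + K * (τ + 1)) + 1, θZ, hδ'', ha₀, by positivity, hθ0, hθ1, fun i α₀ hα₀ hMα U hreg _ y y' _ _ => ?_⟩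
  -- α₀ ≤ a₀ from the guard scale ≥ 1
  have hαa₀ : α₀ ≤ a₀ := (le_mul_of_one_le_left hα₀.le (hM i)).trans hMα
  have hαa₁ : α₀ ≤ a₁ := hαa₀.trans (by rw [ha₀def]; exact min_le_left _ _)
  have hαζ₀ : ζ * α₀ ≤ ζ₀ := by
    have h1 : α₀ ≤ ζ₀ / ζ := hαa₀.trans (by rw [ha₀def]; exact (min_le_right _ _).trans (min_le_left _ _))
    have h2 := mul_le_mul_of_nonneg_left h1 hζ.le
    rwa [mul_div_cancel₀ _ hζ.ne'] at h2
  have hαε : K * (ζ * α₀) ≤ epsCov (d + 1) L δ' := by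
    have h1 : α₀ ≤ epsCov (d + 1) L δ' / (K * ζ) := hαa₀.trans (by rw [ha₀def]; exact (min_le_right _ _).trans (min_le_right _ _))
    have h2 := mul_le_mul_of_nonneg_left h1 hKζ.le
    rw [mul_div_cancel₀ _ hKζ.ne'] at h2
    calc K * (ζ * α₀) = K * ζ * α₀ := by ring
      _ ≤ epsCov (d + 1) L δ' := h2
  have hLk : 1 ≤ L ^ (ι i).k := Nat.one_le_pow _ _ hL1
  have hLm : 1 ≤ L ^ (ι i).m := Nat.one_le_pow _ _ hL1
  have ht0 : 0 ≤ θZ ^ (ι i).k := pow_nonneg hθ0.le _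
  have htinv : (((L ^ (ι i).k : ℕ) : ℝ))⁻¹ ≤ θZ ^ (ι i).k := by
    rw [Nat.cast_pow, ← inv_pow]
    exact pow_le_pow_left₀ (inv_nonneg.mpr hLpos.le) hθL _
  have hn0 : 0 ≤ (((L ^ (ι i).k : ℕ) : ℝ))⁻¹ := by positivity
  have hdvd : ∀ μ, L ∣ TGIndex.Mn d hL (ι i) μ := fun μ => by
    have hm : (ι i).mT ≠ 0 := by have := hι i; omega
    show L ∣ 2 * L ^ (ι i).mT
    exact Dvd.dvd.mul_left (dvd_pow_self L hm) 2
  -- the letters at this index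
  obtain ⟨hZ1, hZ2, hZ3⟩ := HZ i α₀ hα₀ hαa₁ U hreg
  -- V-C: the exact perturbation letters
  obtain ⟨hS1, hS2, hP1, hP2, hP12⟩ := HP (TGIndex.Mn d hL (ι i)) (L ^ (ι i).k) (L ^ (ι i).m * L ^ (ι i).k) (L ^ (ι i).m) hLk hLm rfl
    (Zc i ((pair i).avg U)) (Zf i U) (ζ * α₀) (τ * θZ ^ (ι i).k) (by positivity) hαζ₀ (by positivity) hZ1 hZ2 hZ3
  -- U-A: the perturbed covariance rate
  have hcov := HC (TGIndex.Mn d hL (ι i)) hdvd (L ^ (ι i).k) (L ^ (ι i).m * L ^ (ι i).k) (L ^ (ι i).m) hLk hLm rfl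
    (exDress b (deltaPol (TGIndex.Mn d hL (ι i)) (L ^ (ι i).k)) (Zc i ((pair i).avg U)))
    (exDress b (deltaPol (TGIndex.Mn d hL (ι i)) (L ^ (ι i).m * L ^ (ι i).k)) (Zf i U)) hS1 hS2
    (K * (ζ * α₀)) (K * (τ * θZ ^ (ι i).k + (((L ^ (ι i).k : ℕ) : ℝ))⁻¹))
    (by positivity) hαε (by positivity) hP1 hP2 hP12
    (⟨rep (TGIndex.Mn d hL (ι i)) y, rep_mem_pbox (TGIndex.Mn d hL (ι i)) y⟩, α) (⟨rep (TGIndex.Mn d hL (ι i)) y', rep_mem_pbox (TGIndex.Mn d hL (ι i)) y'⟩, β)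
  have hdist : pdist (TGIndex.Mn d hL (ι i)) (one_le_M (TGIndex.Mn d hL (ι i))) (rep (TGIndex.Mn d hL (ι i)) y) (rep (TGIndex.Mn d hL (ι i)) y')
      = tdistT (TGIndex.Mn d hL (ι i)) y y' := pdist_rep_rep _ _ y y'
  rw [tgCovExOn_ker]
  show |covEx (L := L) (TGIndex.Mn d hL (ι i)) (L ^ (ι i).m * L ^ (ι i).k) b (Zf i U) _ _ - covEx (L := L) (TGIndex.Mn d hL (ι i)) (L ^ (ι i).k) b (Zc i ((pair i).avg U)) _ _|
    ≤ (C' * (1 + K * (τ + 1)) + 1) * Real.exp (-(δ'' * tdistT (TGIndex.Mn d hL (ι i)) y y')) * θZ ^ (ι i).k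
  unfold covEx
  refine hcov.trans ?_
  rw [← hdist]
  have hE := Real.exp_nonneg (-(δ'' * pdist (TGIndex.Mn d hL (ι i)) (one_le_M (TGIndex.Mn d hL (ι i))) (rep (TGIndex.Mn d hL (ι i)) y) (rep (TGIndex.Mn d hL (ι i)) y')))
  have hamp : C' * ((((L ^ (ι i).k : ℕ) : ℝ))⁻¹ + K * (τ * θZ ^ (ι i).k + (((L ^ (ι i).k : ℕ) : ℝ))⁻¹)) ≤ (C' * (1 + K * (τ + 1)) + 1) * θZ ^ (ι i).k := by
    have h2 : K * (τ * θZ ^ (ι i).k + (((L ^ (ι i).k : ℕ) : ℝ))⁻¹) ≤ K * (τ + 1) * θZ ^ (ι i).k := by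
      have := add_le_add (le_refl (τ * θZ ^ (ι i).k)) htinv
      calc K * (τ * θZ ^ (ι i).k + (((L ^ (ι i).k : ℕ) : ℝ))⁻¹) ≤ K * (τ * θZ ^ (ι i).k + θZ ^ (ι i).k) := mul_le_mul_of_nonneg_left this hK.le
        _ = K * (τ + 1) * θZ ^ (ι i).k := by ring
    calc C' * ((((L ^ (ι i).k : ℕ) : ℝ))⁻¹ + K * (τ * θZ ^ (ι i).k + (((L ^ (ι i).k : ℕ) : ℝ))⁻¹))
        ≤ C' * (θZ ^ (ι i).k + K * (τ + 1) * θZ ^ (ι i).k) := mul_le_mul_of_nonneg_left (add_le_add htinv h2) hC'.le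
      _ = (C' * (1 + K * (τ + 1))) * θZ ^ (ι i).k := by ring
      _ ≤ _ := mul_le_mul_of_nonneg_right (by linarith) ht0
  calc C' * ((((L ^ (ι i).k : ℕ) : ℝ))⁻¹ + K * (τ * θZ ^ (ι i).k + (((L ^ (ι i).k : ℕ) : ℝ))⁻¹)) *
        Real.exp (-(δ'' * pdist (TGIndex.Mn d hL (ι i)) (one_le_M (TGIndex.Mn d hL (ι i))) (rep (TGIndex.Mn d hL (ι i)) y) (rep (TGIndex.Mn d hL (ι i)) y')))
      ≤ (C' * (1 + K * (τ + 1)) + 1) * θZ ^ (ι i).k *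
        Real.exp (-(δ'' * pdist (TGIndex.Mn d hL (ι i)) (one_le_M (TGIndex.Mn d hL (ι i))) (rep (TGIndex.Mn d hL (ι i)) y) (rep (TGIndex.Mn d hL (ι i)) y'))) :=
        mul_le_mul_of_nonneg_right hamp hE
    _ = _ := by ring

end Socket

/-! ## §3 ★★★ The knit: an operator layer BY NAME + the letters ⟹ `N15At` with the U-seeing unit layer -/

section Knit

variable {I : Type} (ι : I → TGIndex) (gf : I → B9.Geometry) (Bc Bf : I → B9.Backgrounds)

/-- ★★★ **`N15At` ON ANY SUCH FAMILY FROM AN OPERATOR LAYER BY NAME AND THE MIDDLE FACTORS' LETTERS** (part 78's knit with the EXACTLY DRESSED U-seeing unit layer in place of the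
U-blind `tgCovOn`): OPERATOR = the hypothesis `hop`, SITE = G1's genuine `U ≡ 1` scalar-sector kernel re-based (`tgSiteOn`, U-blind — said), UNIT = §2. [bookkeeping] -/
theorem n15At_tgEx_of_ne2PlusOperator (hd : 1 ≤ d) (hLodd : Odd L) (hL2 : 2 ≤ L) (hL : Odd L ∧ 1 < L) {b aS : ℝ} (hb : 0 < b) (haS : 0 < aS) (α β : Fin (d + 1))
    (hι : ∀ i, 1 ≤ (ι i).mT) (hM : ∀ i, 1 ≤ (gf i).M) (pair : ∀ i, EtaPairing (tgGeoC d hL (ι i)) (gf i) (Bc i) (Bf i)) {c35 : ℝ} (p : ℝ)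
    (Kop : ∀ i, B9.KernelFamily (tgGeoC d hL (ι i)) (Bf i))
    (hop : NE2PlusOperator c35 (fun i => (⟨tgGeoC d hL (ι i), gf i, Bc i, Bf i, pair i⟩ : PairedInstance)) Kop)
    (Zf : ∀ i, (Bf i).Cfg → Matrix (B4.Idx (pbox (TGIndex.Mn d hL (ι i))) (d + 1)) (B4.Idx (pbox (TGIndex.Mn d hL (ι i))) (d + 1)) ℝ)
    (Zc : ∀ i, (Bc i).Cfg → Matrix (B4.Idx (pbox (TGIndex.Mn d hL (ι i))) (d + 1)) (B4.Idx (pbox (TGIndex.Mn d hL (ι i))) (d + 1)) ℝ)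
    {θZ : ℝ} (hθL : (L : ℝ)⁻¹ ≤ θZ) (hθ1 : θZ < 1)
    (hZ : ∃ δZ ζ τ a₁ : ℝ, 0 < δZ ∧ 0 < ζ ∧ 0 < τ ∧ 0 < a₁ ∧
      ∀ (i : I) (α₀ : ℝ), 0 < α₀ → α₀ ≤ a₁ → ∀ U : (Bf i).Cfg, (Bf i).Reg335 c35 α₀ U →
        (∀ p q : B4.Idx (pbox (TGIndex.Mn d hL (ι i))) (d + 1),
            |Zc i ((pair i).avg U) p q| ≤ ζ * α₀ * Real.exp (-(δZ * pdist (TGIndex.Mn d hL (ι i)) (one_le_M _) (p.1 : Fin (d + 1) → ℤ) (q.1 : Fin (d + 1) → ℤ)))) ∧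
        (∀ p q : B4.Idx (pbox (TGIndex.Mn d hL (ι i))) (d + 1),
            |Zf i U p q| ≤ ζ * α₀ * Real.exp (-(δZ * pdist (TGIndex.Mn d hL (ι i)) (one_le_M _) (p.1 : Fin (d + 1) → ℤ) (q.1 : Fin (d + 1) → ℤ)))) ∧
        (∀ p q : B4.Idx (pbox (TGIndex.Mn d hL (ι i))) (d + 1),
            |Zf i U p q - Zc i ((pair i).avg U) p q| ≤ τ * θZ ^ (ι i).k * Real.exp (-(δZ * pdist (TGIndex.Mn d hL (ι i)) (one_le_M _) (p.1 : Fin (d + 1) → ℤ) (q.1 : Fin (d + 1) → ℤ))))) :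
    N15At { I := I, c35 := c35, p := p, pi := fun i => ⟨tgGeoC d hL (ι i), gf i, Bc i, Bf i, pair i⟩, Kop := Kop, Ksite := tgSiteOn d hL aS ι Bf,
            Kunit := tgCovExOn ι gf Bc Bf d hL b α β pair Zf Zc, inΛ := fun _ _ => True, unitDist := fun i => (tgGeoC d hL (ι i)).dist } :=
  ⟨hop, ne2PlusSite_tgSiteOn (d := d) ι gf Bc Bf hLodd hL2 hL haS pair 4 p c35,
   ne2PlusUnit_tgCovExOn_of_letters (d := d) ι gf Bc Bf hd hL2 hL hb c35 α β hι hM pair Zf Zc hθL hθ1 hZ⟩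

end Knit

end Summit.QuantumFields.YangMills.BalabanUVNodes.N15.UnitLayerBg

end
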